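import Summits.MatrixMultiplication.OmegaCensus.TriangleTorusShearedImbalance
import Summits.MatrixMultiplication.OmegaCensus.ThreeSetNoPartThree
import Mathlib.Algebra.Group.Subgroup.ZPowers.Basic

/-!
# A part of size three in a cube symmetric form over ANY finite abelian group forces `|A| ≤ 12·ord + 7` (kernel)

ω-census `pub-omega`, family (b3), seat pub-omega-group gen 34.  Framing: lottery ticket; floor = certified bounds/negative
ranges.  VALUE: a KERNEL theorem of the group-theoretic (Cohn–Umans) census of three-set cube law triples, extending the
all-prime theorem of `ThreeSetNoPartThree` (g33: no part of size `3` over `ℤ_p × ℤ_p`) to ARBITRARY finite abelian groups;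
NOT progress on ω and no census word changes (every cell in range was already NONE by engines or by g33).

Let `(W, X, Y, x₀)` be a cube symmetric form over a finite abelian group `A` (the three signed sums `−w+x+y`, `w−x+y`, `w+x−y`
injective on `W × X × Y`, pairwise disjoint, covering `A ∖ {x₀}` — the conclusion of `cube_symmetric_form_of_law`).
* `shearedFactorOfFinsets` / `card_sub_card_bound_general` — the bridge: if `{0, u, v} + t` (`t ∈ T`) and `m − {0, u, v}`
  (`m ∈ M`) partition `A ∖ {z₀}` and `u, v` generate `A`, then `(c, j) ↦ c•u + j•v + z₀` pulls the partition back to a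
  triangle factor of the punctured SHEARED torus `ℤ² / ⟨(a, s), (0, ord v)⟩` (`a` = the order of `u` modulo `⟨v⟩`,
  `a•u + s•v = 0`), and `ShearedFactor.three_mul_abs_sub_le` gives `3·|#T − #M| ≤ 4·ord v + 2`.
* **`card_le_of_cube_form_part_three`** — if `|W| = 3` then for any two distinct `w, w' ∈ W`:
  `|A| ≤ 12 · addOrderOf (w' − w) + 7`.  (Coset lemma `card_eq_one_of_subset_coset` ⇒ the two difference vectors of `W`
  generate `A`; tiling form `cube_form_tiling` ⇒ `#T − #M = |X||Y| = (|A| − 1)/9`; then the bridge.)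
* `exists_generators_of_cube_form_part_three` — in particular `A` is generated by two elements.
* Consequences (no part of size `3` when all orders are `≤ e` with `12e + 7 < |A|`; over `ℤ_n × ℤ_n` for every
  `n ∉ {8, 10}`; the Dih(A) law corollaries) are in `ThreeSetNoPartThreeCorollaries.lean`.
-/

namespace Summit.MatrixMultiplication.OmegaCensus

open Finset TriangleTorus

section Bridge

variable {A : Type*} [AddCommGroup A] [DecidableEq A] [Fintype A]

omit [DecidableEq A] [Fintype A] in
/-- The six neighbours used by the covering axiom: `(c ± 1)•u + j•v` and `c•u + (j ± 1)•v`. [folklore] -/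
theorem zsmul_coords_shift (u v z₀ : A) (c j : ℤ) :
    (c + 1) • u + j • v + z₀ = c • u + j • v + z₀ + u ∧ c • u + (j + 1) • v + z₀ = c • u + j • v + z₀ + v ∧
    (c - 1) • u + j • v + z₀ = c • u + j • v + z₀ - u ∧ c • u + (j - 1) • v + z₀ = c • u + j • v + z₀ - v := by
  refine ⟨?_, ?_, ?_, ?_⟩
  · rw [add_zsmul, one_zsmul]; abel
  · rw [add_zsmul, one_zsmul]; abel
  · rw [sub_zsmul, one_zsmul]; abel
  · rw [sub_zsmul, one_zsmul]; abel

/-- **The sheared triangle factor of a Finset partition.**  Up-triangles `t + {0, u, v}` (`t ∈ T`) and down-triangles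
`m − {0, u, v}` (`m ∈ M`) partitioning `A ∖ {z₀}` (counting form), pulled back along `(c, j) ↦ c•u + j•v + z₀`, form a
`ShearedFactor (ord v) a s` whenever `a•u + s•v = 0` and `c•u ∈ ⟨v⟩ ⇒ a ∣ c`. [folklore] -/
def shearedFactorOfFinsets (u v : A) (a : ℕ) (s : ℤ) (T M : Finset A) (z₀ : A) (hu : u ≠ 0) (hv : v ≠ 0) (huv : u ≠ v)
    (has : (a : ℤ) • u + s • v = 0) (hdiv : ∀ c j : ℤ, c • u + j • v = 0 → (a : ℤ) ∣ c)
    (h : ∀ x, (M.filter fun m => m - x ∈ ({0, u, v} : Finset A)).card +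
      (T.filter fun t => x - t ∈ ({0, u, v} : Finset A)).card = if x = z₀ then 0 else 1) :
    ShearedFactor (addOrderOf v) a s where
  up c j := decide (c • u + j • v + z₀ ∈ T)
  dn c j := decide (c • u + j • v + z₀ ∈ M)
  hole c j := decide (c • u + j • v = 0)
  up_add_right c j := by
    rw [add_zsmul, natCast_zsmul, addOrderOf_nsmul_eq_zero, add_zero]
  dn_add_right c j := by
    rw [add_zsmul, natCast_zsmul, addOrderOf_nsmul_eq_zero, add_zero]
  up_add_left c j := by
    rw [show (c + a) • u + (j + s) • v + z₀ = c • u + j • v + z₀ + ((a : ℤ) • u + s • v) by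
      rw [add_zsmul, add_zsmul]; abel, has, add_zero]
  dn_add_left c j := by
    rw [show (c + a) • u + (j + s) • v + z₀ = c • u + j • v + z₀ + ((a : ℤ) • u + s • v) by
      rw [add_zsmul, add_zsmul]; abel, has, add_zero]
  hole_col c j hc := hdiv c j (by simpa using hc)
  hole_uniq c j j' hc hc' := by
    have e₁ : c • u + j • v = 0 := by simpa using hc
    have e₂ : c • u + j' • v = 0 := by simpa using hc'
    refine addOrderOf_dvd_iff_zsmul_eq_zero.2 ?_
    have : j' • v = j • v := add_left_cancel (e₂.trans e₁.symm)
    rw [sub_zsmul, this]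
    simp
  cover c j := by
    obtain ⟨p1, p2, p3, p4⟩ := zsmul_coords_shift u v z₀ c j
    set x : A := c • u + j • v + z₀ with hx
    have hxu : x ≠ x + u := fun h' => hu (left_eq_add.1 h')
    have hxv : x ≠ x + v := fun h' => hv (left_eq_add.1 h')
    have huv' : x + u ≠ x + v := fun h' => huv (add_left_cancel h')
    -- the down-triangles through `x`
    have hM : ((M.filter fun m => m - x ∈ ({0, u, v} : Finset A)).card : ℤ) =
        (if x ∈ M then 1 else 0) + (if x + u ∈ M then 1 else 0) + (if x + v ∈ M then 1 else 0) := by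
      refine card_filter_three M x (x + u) (x + v) hxu hxv huv' _ fun m => ?_
      simp only [mem_insert, mem_singleton]
      constructor
      · rintro (h' | h' | h')
        · exact Or.inl (sub_eq_zero.1 h')
        · exact Or.inr (Or.inl (by rw [← h']; abel))
        · exact Or.inr (Or.inr (by rw [← h']; abel))
      · rintro (rfl | rfl | rfl)
        · exact Or.inl (sub_self x)
        · exact Or.inr (Or.inl (by abel))
        · exact Or.inr (Or.inr (by abel))
    -- the up-triangles through `x`
    have hxu' : x ≠ x - u := fun h' => hu (sub_eq_self.1 h'.symm)
    have hxv' : x ≠ x - v := fun h' => hv (sub_eq_self.1 h'.symm)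
    have huv'' : x - u ≠ x - v := fun h' => huv (sub_right_injective h')
    have hT : ((T.filter fun t => x - t ∈ ({0, u, v} : Finset A)).card : ℤ) =
        (if x ∈ T then 1 else 0) + (if x - u ∈ T then 1 else 0) + (if x - v ∈ T then 1 else 0) := by
      refine card_filter_three T x (x - u) (x - v) hxu' hxv' huv'' _ fun t => ?_
      simp only [mem_insert, mem_singleton]
      constructor
      · rintro (h' | h' | h')
        · exact Or.inl (sub_eq_zero.1 h').symm
        · exact Or.inr (Or.inl (by rw [← h']; abel))
        · exact Or.inr (Or.inr (by rw [← h']; abel))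
      · rintro (rfl | rfl | rfl)
        · exact Or.inl (sub_self x)
        · exact Or.inr (Or.inl (by abel))
        · exact Or.inr (Or.inr (by abel))
    have hc' : (if x ∈ M then 1 else 0) + (if x + u ∈ M then 1 else 0) + (if x + v ∈ M then 1 else 0) +
        ((if x ∈ T then 1 else 0) + (if x - u ∈ T then 1 else 0) + (if x - v ∈ T then 1 else 0)) =
        (((if x = z₀ then 0 else 1 : ℕ)) : ℤ) := by
      rw [← hM, ← hT]; exact_mod_cast h x
    have hz : c • u + j • v = 0 ↔ x = z₀ := by rw [hx, add_eq_right]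
    simp only [p1, p2, p3, p4, decide_eq_true_eq, hz]
    zify
    simp only [toNat_decide_cast]
    push_cast at hc'
    linarith

/-- **Coordinates on a two-generated finite abelian group.**  If `u, v` generate `A`, `a ≥ 1`, `a•u + s•v = 0` and
`c•u ∈ ⟨v⟩ ⇒ a ∣ c`, then `(c, j) ↦ c•u + j•v + z₀` is a bijection from `[0, a) × [0, ord v)` onto `A`; stated as the
counting identity used for the tile counts. [folklore] -/
theorem sum_sum_indicator_sheared (u v z₀ : A) (a : ℕ) (s : ℤ) (ha : 0 < a) (has : (a : ℤ) • u + s • v = 0)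
    (hdiv : ∀ c : ℤ, c • u ∈ AddSubgroup.zmultiples v → (a : ℤ) ∣ c) (hgen : ∀ x : A, ∃ i k : ℤ, i • u + k • v = x)
    (S : Finset A) :
    (∑ c ∈ range a, ∑ j ∈ range (addOrderOf v), if (c : ℤ) • u + (j : ℤ) • v + z₀ ∈ S then (1 : ℤ) else 0) = S.card := by
  set n := addOrderOf v with hn_def
  have hn : 0 < n := addOrderOf_pos v
  have hnv : (n : ℤ) • v = 0 := by rw [natCast_zsmul, hn_def, addOrderOf_nsmul_eq_zero]
  rw [← Finset.sum_product' (f := fun (c j : ℕ) => if (c : ℤ) • u + (j : ℤ) • v + z₀ ∈ S then (1 : ℤ) else 0),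
    Finset.sum_boole]
  congr 1
  refine card_bij (fun p _ => (p.1 : ℤ) • u + (p.2 : ℤ) • v + z₀) (fun p hp => (mem_filter.1 hp).2) ?_ ?_
  · intro p hp q hq he
    have hp' := mem_product.1 (mem_filter.1 hp).1
    have hq' := mem_product.1 (mem_filter.1 hq).1
    rw [mem_range, mem_range] at hp' hq'
    have he' : (p.1 : ℤ) • u + (p.2 : ℤ) • v = (q.1 : ℤ) • u + (q.2 : ℤ) • v := add_right_cancel he
    have e1 : ((p.1 : ℤ) - q.1) • u = ((q.2 : ℤ) - p.2) • v := by
      rw [sub_zsmul, sub_zsmul]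
      calc (p.1 : ℤ) • u + -((q.1 : ℤ) • u)
          = ((p.1 : ℤ) • u + (p.2 : ℤ) • v) + -((q.1 : ℤ) • u) + -((p.2 : ℤ) • v) := by abel
        _ = ((q.1 : ℤ) • u + (q.2 : ℤ) • v) + -((q.1 : ℤ) • u) + -((p.2 : ℤ) • v) := by rw [he']
        _ = (q.2 : ℤ) • v + -((p.2 : ℤ) • v) := by abel
    have hd : (a : ℤ) ∣ (p.1 : ℤ) - q.1 := hdiv _ (by rw [e1]; exact AddSubgroup.zsmul_mem_zmultiples v _)
    have h1 : (p.1 : ℤ) = q.1 := by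
      have := Int.eq_zero_of_abs_lt_dvd hd (by rw [abs_lt]; constructor <;> omega)
      omega
    have h2 : (p.2 : ℤ) = q.2 := by
      rw [h1, sub_self, zero_zsmul] at e1
      have hdn : (n : ℤ) ∣ (q.2 : ℤ) - p.2 := addOrderOf_dvd_iff_zsmul_eq_zero.2 e1.symm
      have := Int.eq_zero_of_abs_lt_dvd hdn (by rw [abs_lt]; constructor <;> omega)
      omega
    exact Prod.ext (by exact_mod_cast h1) (by exact_mod_cast h2)
  · intro x hx
    obtain ⟨i, k, hik⟩ := hgen (x - z₀)
    have ha0 : (0 : ℤ) < a := by exact_mod_cast ha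
    have hn0 : (0 : ℤ) < n := by exact_mod_cast hn
    -- reduce `i` modulo `a` (using `a•u = −s•v`) and then the `v`-coefficient modulo `n`
    set q : ℤ := i / a with hq
    set c : ℤ := i % a with hc
    set k' : ℤ := k - q * s with hk'
    set j : ℤ := k' % n with hj
    have hc0 : 0 ≤ c := Int.emod_nonneg _ ha0.ne'
    have hca : c < a := Int.emod_lt_of_pos _ ha0
    have hj0 : 0 ≤ j := Int.emod_nonneg _ hn0.ne'
    have hjn : j < n := Int.emod_lt_of_pos _ hn0
    have hi : i = a * q + c := (Int.mul_ediv_add_emod i a).symm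
    have hk'' : k' = (k' / n) * n + j := by rw [mul_comm]; exact (Int.mul_ediv_add_emod k' n).symm
    have key : c • u + j • v = i • u + k • v := by
      have e1 : i • u = q • ((a : ℤ) • u) + c • u := by rw [hi, add_zsmul, mul_comm, mul_zsmul]
      have e2 : (a : ℤ) • u = -(s • v) := eq_neg_of_add_eq_zero_left has
      have e3 : k • v = k' • v + q • (s • v) := by rw [hk', sub_zsmul, mul_zsmul]; abel
      have e4 : k' • v = (k' / n) • ((n : ℤ) • v) + j • v := by
        conv_lhs => rw [hk'']
        rw [add_zsmul, mul_zsmul]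
      rw [e1, e2, e3, e4, hnv, zsmul_zero, zero_add, zsmul_neg]; abel
    refine ⟨(c.toNat, j.toNat), mem_filter.2 ⟨mem_product.2 ⟨mem_range.2 (by omega), mem_range.2 (by omega)⟩, ?_⟩, ?_⟩
    · simp only [Int.toNat_of_nonneg hc0, Int.toNat_of_nonneg hj0, key, hik, sub_add_cancel]; exact hx
    · simp only [Int.toNat_of_nonneg hc0, Int.toNat_of_nonneg hj0, key, hik, sub_add_cancel]

/-- **Theorem B pulled back to a two-generated group.**  If the up-triangles `t + {0, u, v}` (`t ∈ T`) and down-triangles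
`m − {0, u, v}` (`m ∈ M`) partition `A ∖ {z₀}`, where `u ≠ v` are non-zero, `u, v` generate `A` and `3 ∤ ord v`, then
`3·|#T − #M| ≤ 4·ord v + 2`. [folklore] -/
theorem card_sub_card_bound_general (u v : A) (hu : u ≠ 0) (hv : v ≠ 0) (huv : u ≠ v)
    (hgen : ∀ x : A, ∃ i k : ℤ, i • u + k • v = x) (h3 : ¬ 3 ∣ addOrderOf v) (T M : Finset A) (z₀ : A)
    (h : ∀ x, (M.filter fun m => m - x ∈ ({0, u, v} : Finset A)).card +
      (T.filter fun t => x - t ∈ ({0, u, v} : Finset A)).card = if x = z₀ then 0 else 1) :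
    3 * |(T.card : ℤ) - M.card| ≤ 4 * addOrderOf v + 2 := by
  classical
  -- the number of columns `a` = the order of `u` modulo `⟨v⟩`, and the shear `s`
  have hex : ∃ a : ℕ, 0 < a ∧ (a : ℤ) • u ∈ AddSubgroup.zmultiples v :=
    ⟨addOrderOf u, addOrderOf_pos u, by rw [natCast_zsmul, addOrderOf_nsmul_eq_zero]; exact AddSubgroup.zero_mem _⟩
  obtain ⟨ha, hamem⟩ := Nat.find_spec hex
  set a := Nat.find hex with ha_def
  have hmin : ∀ b : ℕ, 0 < b → (b : ℤ) • u ∈ AddSubgroup.zmultiples v → a ≤ b :=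
    fun b hb hbm => Nat.find_min' hex ⟨hb, hbm⟩
  obtain ⟨k, hk⟩ := AddSubgroup.mem_zmultiples_iff.1 hamem
  have has : (a : ℤ) • u + (-k) • v = 0 := by rw [← hk, neg_zsmul, add_neg_cancel]
  have ha0 : (0 : ℤ) < a := by exact_mod_cast ha
  have hdiv : ∀ c : ℤ, c • u ∈ AddSubgroup.zmultiples v → (a : ℤ) ∣ c := by
    intro c hc
    have hr : (c % a) • u ∈ AddSubgroup.zmultiples v := by
      rw [show c % a = c - (c / a) * a by rw [Int.emod_def]; ring, sub_zsmul, mul_zsmul]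
      exact add_mem hc (neg_mem (AddSubgroup.zsmul_mem _ hamem _))
    by_contra hnd
    have hr0 : c % a ≠ 0 := fun h0 => hnd (Int.dvd_of_emod_eq_zero h0)
    have hrpos : 0 < c % a := lt_of_le_of_ne (Int.emod_nonneg _ ha0.ne') (Ne.symm hr0)
    have hrlt : c % a < a := Int.emod_lt_of_pos _ ha0
    have hle := hmin (c % a).toNat (by omega) (by rwa [Int.toNat_of_nonneg hrpos.le])
    omega
  have hdiv' : ∀ c j : ℤ, c • u + j • v = 0 → (a : ℤ) ∣ c := fun c j hcj =>
    hdiv c (AddSubgroup.mem_zmultiples_iff.2 ⟨-j, by rw [neg_zsmul]; exact neg_eq_of_add_eq_zero_left hcj⟩)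
  -- the sheared triangle factor and its tile counts
  set F := shearedFactorOfFinsets u v a (-k) T M z₀ hu hv huv has hdiv' h with hF
  have hup : F.upCount = T.card := by
    unfold ShearedFactor.upCount
    simp only [hF, shearedFactorOfFinsets, decide_eq_true_eq]
    exact sum_sum_indicator_sheared u v z₀ a (-k) ha has hdiv hgen T
  have hdn : F.dnCount = M.card := by
    unfold ShearedFactor.dnCount
    simp only [hF, shearedFactorOfFinsets, decide_eq_true_eq]
    exact sum_sum_indicator_sheared u v z₀ a (-k) ha has hdiv hgen M
  have := F.three_mul_abs_sub_le h3 (addOrderOf_pos v) ha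
  rwa [hup, hdn] at this

end Bridge

section Corollary

variable {A : Type*} [AddCommGroup A] [DecidableEq A] [Fintype A]

omit [AddCommGroup A] [Fintype A] in
/-- A three-element Finset containing three given distinct elements is exactly those. [folklore] -/
theorem eq_triple_of_card_three {W : Finset A} {x y z : A} (hW : W.card = 3) (hx : x ∈ W) (hy : y ∈ W) (hz : z ∈ W)
    (hxy : x ≠ y) (hxz : x ≠ z) (hyz : y ≠ z) : W = {x, y, z} := by
  symm
  refine eq_of_subset_of_card_le ?_ ?_
  · intro t ht
    simp only [mem_insert, mem_singleton] at ht
    rcases ht with rfl | rfl | rfl <;> assumption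
  · rw [hW, card_insert_of_notMem (by simp [hxy, hxz]), card_insert_of_notMem (by simp [hyz]), card_singleton]

/-- **A part of size three forces `|A| ≤ 12·ord(w' − w) + 7`** for any two distinct points `w, w'` of the part (kernel,
every finite abelian `A`).  With `W = {w, w', w''}`: translate by `−w`; the coset lemma shows that `u = w'' − w` and
`v = w' − w` generate `A`; the tiling form of the cube symmetric form is a triangle factor of the punctured sheared torus
with `#up − #down = |X||Y| = (|A| − 1)/9`; Theorem B bounds this by `(4·ord v + 2)/3`. [folklore] -/
theorem card_le_of_cube_form_part_three {W X Y : Finset A} {x₀ : A}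
    (h₁ : Set.InjOn (fun p : A × A × A => -p.1 + p.2.1 + p.2.2) ↑(W ×ˢ X ×ˢ Y))
    (h₂ : Set.InjOn (fun p : A × A × A => p.1 - p.2.1 + p.2.2) ↑(W ×ˢ X ×ˢ Y))
    (h₃ : Set.InjOn (fun p : A × A × A => p.1 + p.2.1 - p.2.2) ↑(W ×ˢ X ×ˢ Y))
    (d₁₂ : Disjoint ((W ×ˢ X ×ˢ Y).image fun p : A × A × A => -p.1 + p.2.1 + p.2.2)
      ((W ×ˢ X ×ˢ Y).image fun p : A × A × A => p.1 - p.2.1 + p.2.2))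
    (d₁₃ : Disjoint ((W ×ˢ X ×ˢ Y).image fun p : A × A × A => -p.1 + p.2.1 + p.2.2)
      ((W ×ˢ X ×ˢ Y).image fun p : A × A × A => p.1 + p.2.1 - p.2.2))
    (d₂₃ : Disjoint ((W ×ˢ X ×ˢ Y).image fun p : A × A × A => p.1 - p.2.1 + p.2.2)
      ((W ×ˢ X ×ˢ Y).image fun p : A × A × A => p.1 + p.2.1 - p.2.2))
    (hcover : ((W ×ˢ X ×ˢ Y).image fun p : A × A × A => -p.1 + p.2.1 + p.2.2) ∪
      ((W ×ˢ X ×ˢ Y).image fun p : A × A × A => p.1 - p.2.1 + p.2.2) ∪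
      ((W ×ˢ X ×ˢ Y).image fun p : A × A × A => p.1 + p.2.1 - p.2.2) = univ.erase x₀)
    (hW : W.card = 3) {w w' : A} (hw : w ∈ W) (hw' : w' ∈ W) (hne : w ≠ w') :
    Fintype.card A ≤ 12 * addOrderOf (w' - w) + 7 := by
  classical
  -- the third point
  obtain ⟨w'', hw''W, hw''w, hw''w'⟩ : ∃ w'' ∈ W, w'' ≠ w ∧ w'' ≠ w' := by
    have hc : ((W.erase w).erase w').card = 1 := by
      rw [card_erase_of_mem (mem_erase.2 ⟨hne.symm, hw'⟩), card_erase_of_mem hw, hW]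
    obtain ⟨w'', hw''⟩ := card_eq_one.1 hc
    have hm : w'' ∈ (W.erase w).erase w' := by rw [hw'']; exact mem_singleton_self _
    exact ⟨w'', (mem_erase.1 (mem_erase.1 hm).2).2, (mem_erase.1 (mem_erase.1 hm).2).1, (mem_erase.1 hm).1⟩
  have hWeq : W = {w, w'', w'} := eq_triple_of_card_three hW hw hw''W hw' hw''w.symm hne hw''w'
  -- translate by `−w`
  obtain ⟨t₁, t₂, t₃, e₁₂, e₁₃, e₂₃, tcov, -, cX, cY⟩ :=
    cube_symmetric_form_translate h₁ h₂ h₃ d₁₂ d₁₃ d₂₃ hcover (-w)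
  set u : A := w'' - w with hu_def
  set v : A := w' - w with hv_def
  have hWt : W.image (· + -w) = {0, u, v} := by
    rw [hWeq, image_insert, image_insert, image_singleton, add_neg_cancel, hu_def, hv_def, sub_eq_add_neg,
      sub_eq_add_neg]
  rw [hWt] at t₁ t₂ t₃ e₁₂ e₁₃ e₂₃ tcov
  have hu : u ≠ 0 := sub_ne_zero.2 hw''w
  have hv : v ≠ 0 := sub_ne_zero.2 hne.symm
  have huv : u ≠ v := fun h => hw''w' (sub_left_injective h)
  -- `u, v` generate `A` (coset lemma)
  have hgen : ∀ x : A, ∃ i k : ℤ, i • u + k • v = x := by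
    intro x
    have htop : AddSubgroup.closure ({u, v} : Set A) = ⊤ := by
      by_contra hH
      have h1 := card_eq_one_of_subset_coset t₁ t₂ t₃ e₁₂ e₁₃ e₂₃ tcov _ hH 0 (fun y hy => by
        rw [sub_zero]
        simp only [mem_insert, mem_singleton] at hy
        rcases hy with rfl | rfl | rfl
        · exact AddSubgroup.zero_mem _
        · exact AddSubgroup.subset_closure (by simp)
        · exact AddSubgroup.subset_closure (by simp))
      rw [card_insert_of_notMem (by simp [hu.symm, hv.symm]), card_insert_of_notMem (by simp [huv]),
        card_singleton] at h1
      omega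
    have hx : x ∈ AddSubgroup.closure ({u, v} : Set A) := by rw [htop]; exact AddSubgroup.mem_top x
    exact AddSubgroup.mem_closure_pair.1 hx
  -- the tiling form
  have hne0 : ({0, u, v} : Finset A).Nonempty := ⟨0, by simp⟩
  obtain ⟨htile, -, hM, hT⟩ := cube_form_tiling hne0 t₁ t₂ t₃ e₁₂ e₁₃ e₂₃ tcov
  -- arithmetic: `9|X||Y| + 1 = |A|`, `3 ∤ ord v`
  have hcount := three_mul_card_add_one_eq h₁ h₂ h₃ d₁₂ d₁₃ d₂₃ hcover
  rw [hW] at hcount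
  have h3 : ¬ 3 ∣ addOrderOf v := by
    intro h3
    have : 3 ∣ Fintype.card A := h3.trans (addOrderOf_dvd_card)
    omega
  have hb := card_sub_card_bound_general u v hu hv huv hgen h3 _ _ _ htile
  rw [hT, hM, cX, cY, Nat.cast_mul, show ((2 : ℕ) : ℤ) * ((X.card * Y.card : ℕ) : ℤ) - ((X.card * Y.card : ℕ) : ℤ) =
    ((X.card * Y.card : ℕ) : ℤ) by ring, abs_of_nonneg (by positivity)] at hb
  have : (3 * (X.card * Y.card) : ℤ) ≤ 4 * addOrderOf v + 2 := by exact_mod_cast hb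
  have hc' : (3 * (3 * X.card * Y.card) + 1 : ℤ) = Fintype.card A := by exact_mod_cast hcount
  have : (Fintype.card A : ℤ) ≤ 12 * addOrderOf v + 7 := by linarith
  exact_mod_cast this

/-- **A part of size three forces `A` to be two-generated** (by the two difference vectors of the part). [folklore] -/
theorem exists_generators_of_cube_form_part_three {W X Y : Finset A} {x₀ : A}
    (h₁ : Set.InjOn (fun p : A × A × A => -p.1 + p.2.1 + p.2.2) ↑(W ×ˢ X ×ˢ Y))
    (h₂ : Set.InjOn (fun p : A × A × A => p.1 - p.2.1 + p.2.2) ↑(W ×ˢ X ×ˢ Y))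
    (h₃ : Set.InjOn (fun p : A × A × A => p.1 + p.2.1 - p.2.2) ↑(W ×ˢ X ×ˢ Y))
    (d₁₂ : Disjoint ((W ×ˢ X ×ˢ Y).image fun p : A × A × A => -p.1 + p.2.1 + p.2.2)
      ((W ×ˢ X ×ˢ Y).image fun p : A × A × A => p.1 - p.2.1 + p.2.2))
    (d₁₃ : Disjoint ((W ×ˢ X ×ˢ Y).image fun p : A × A × A => -p.1 + p.2.1 + p.2.2)
      ((W ×ˢ X ×ˢ Y).image fun p : A × A × A => p.1 + p.2.1 - p.2.2))
    (d₂₃ : Disjoint ((W ×ˢ X ×ˢ Y).image fun p : A × A × A => p.1 - p.2.1 + p.2.2)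
      ((W ×ˢ X ×ˢ Y).image fun p : A × A × A => p.1 + p.2.1 - p.2.2))
    (hcover : ((W ×ˢ X ×ˢ Y).image fun p : A × A × A => -p.1 + p.2.1 + p.2.2) ∪
      ((W ×ˢ X ×ˢ Y).image fun p : A × A × A => p.1 - p.2.1 + p.2.2) ∪
      ((W ×ˢ X ×ˢ Y).image fun p : A × A × A => p.1 + p.2.1 - p.2.2) = univ.erase x₀)
    (hW : W.card = 3) : ∃ u v : A, AddSubgroup.closure ({u, v} : Set A) = ⊤ := by
  classical
  obtain ⟨w, w'', w', hww'', hww', hw''w', hWeq⟩ := card_eq_three.1 hW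
  obtain ⟨t₁, t₂, t₃, e₁₂, e₁₃, e₂₃, tcov, -, -, -⟩ :=
    cube_symmetric_form_translate h₁ h₂ h₃ d₁₂ d₁₃ d₂₃ hcover (-w)
  have hWt : W.image (· + -w) = {0, w'' - w, w' - w} := by
    rw [hWeq, image_insert, image_insert, image_singleton, add_neg_cancel, sub_eq_add_neg, sub_eq_add_neg]
  rw [hWt] at t₁ t₂ t₃ e₁₂ e₁₃ e₂₃ tcov
  refine ⟨w'' - w, w' - w, ?_⟩
  by_contra hH
  have h1 := card_eq_one_of_subset_coset t₁ t₂ t₃ e₁₂ e₁₃ e₂₃ tcov _ hH 0 (fun y hy => by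
    rw [sub_zero]
    simp only [mem_insert, mem_singleton] at hy
    rcases hy with rfl | rfl | rfl
    · exact AddSubgroup.zero_mem _
    · exact AddSubgroup.subset_closure (by simp)
    · exact AddSubgroup.subset_closure (by simp))
  have hu : w'' - w ≠ 0 := sub_ne_zero.2 hww''.symm
  have hv : w' - w ≠ 0 := sub_ne_zero.2 hww'.symm
  have huv : w'' - w ≠ w' - w := fun h => hw''w' (sub_left_injective h)
  rw [card_insert_of_notMem (by simp [hu.symm, hv.symm]), card_insert_of_notMem (by simp [huv]),
    card_singleton] at h1
  omega

end Corollary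

end Summit.MatrixMultiplication.OmegaCensus
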